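import Summits.AnomalousDissipation.AnomalousDissipation.Theorems.MarginalStabilityChainChainRealisationStubCompactLimitsOfShiftsA2
import Literature.Analysis.FunctionSpaces.TorusClassicalNSRestart
import Literature.Analysis.FluidPDE.PeriodicBoundedMildTorus
import Literature.Analysis.FunctionSpaces.FlatTorusProofs
import HarnessLib

/-!
# Stub `stub_compactLimitsOfShifts` of the line `SketchIdeator2`, part B: compact limits of
# UNBOUNDED sequences of time-translates (crux stmt-AnomalousDissipation-14249)

For a forward classical Navier–Stokes solution `(u, p)` on `[0,∞) × T³` (steady force, mean-zero
slices) whose lifts `stLift u`, `stLift (p − p(·,0))` have all derivatives bounded on `(0,∞) × ℝ³`,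
and `sₙ ≥ 1`, the translates `u(· + sₙ)` have — granting the Arzelà–Ascoli statement of the
registered stub `stub_ascoliSmooth` as a hypothesis — a subsequence converging in `L²` and `H¹`,
uniformly on every `[0,T]`, to a forward classical mean-zero solution (`clsB_compactLimit_of_unbounded`,
registered form `clsB_compactLimitUnbounded`): translated lifts on `O = Ioi (−1) × ℝ³`
(`iteratedFDeriv_comp_add_right`), Ascoli twice, `ℤ³`-periodic limits descended through `repr`,
within-derivatives on `Ici 0 × ℝ³ ⊂ O` are honest, part A2 makes the limit classical, and uniform
convergence of `D⁰`, `D¹` on `[0,T] × (unit cube)` gives the `L²`/`H¹` clause (part A).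
Reference: Foias–Manley–Rosa–Temam, *Navier–Stokes Equations and Turbulence* (2001), Ch. III §2.
-/

set_option linter.dupNamespace false

noncomputable section

open MeasureTheory Set Filter Topology
open scoped InnerProductSpace
open Literature.Analysis.FunctionSpaces Literature.Analysis.FunctionSpaces.Torus

namespace Summit.AnomalousDissipation.AnomalousDissipation.Theorems.ChainRealisation.SeparatrixFluxPinning


/-- The space–time lift is `ℤ³`-periodic in the space variable. -/
theorem clsB_stLift_add_single {G : Type*} (w : ℝ → UnitAddTorus (Fin 3) → G) (t : ℝ)
    (y : EuclideanSpace ℝ (Fin 3)) (j : Fin 3) :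
    stLift w (t, y + EuclideanSpace.single j 1) = stLift w (t, y) :=
  isLatticePeriodic_lift (w t) j y

/-- At a point of `D = Ici a × ℝ³` a map differentiable there (honestly) has
`fderivWithin D = fderiv`. -/
theorem clsB_fderivWithin_eq_fderiv {G : Type*} [NormedAddCommGroup G] [NormedSpace ℝ G] {a : ℝ}
    {f : ℝ × EuclideanSpace ℝ (Fin 3) → G} {z : ℝ × EuclideanSpace ℝ (Fin 3)}
    (hz : z ∈ Ici a ×ˢ (univ : Set (EuclideanSpace ℝ (Fin 3)))) (hf : DifferentiableAt ℝ f z) :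
    fderivWithin ℝ f (Ici a ×ˢ univ) z = fderiv ℝ f z :=
  fderivWithin_eq_fderiv (((uniqueDiffOn_Ici a).prod uniqueDiffOn_univ) z hz) hf

/-- For a map `C^∞` on an open set `O ⊇ Ici a × ℝ³`, second derivatives within `Ici a × ℝ³` at
its points are honest second derivatives. -/
theorem clsB_fderivWithin_fderivWithin_eq {G : Type*} [NormedAddCommGroup G] [NormedSpace ℝ G] {a : ℝ}
    {O : Set (ℝ × EuclideanSpace ℝ (Fin 3))} (hO : IsOpen O)
    (hDO : Ici a ×ˢ (univ : Set (EuclideanSpace ℝ (Fin 3))) ⊆ O)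
    {f : ℝ × EuclideanSpace ℝ (Fin 3) → G} (hf : ContDiffOn ℝ (⊤ : ℕ∞) f O)
    {z : ℝ × EuclideanSpace ℝ (Fin 3)} (hz : z ∈ Ici a ×ˢ (univ : Set (EuclideanSpace ℝ (Fin 3)))) :
    fderivWithin ℝ (fderivWithin ℝ f (Ici a ×ˢ univ)) (Ici a ×ˢ univ) z = fderiv ℝ (fderiv ℝ f) z := by
  have hdf : ∀ w ∈ O, DifferentiableAt ℝ f w := fun w hw =>
    (hf.differentiableOn (by simp)).differentiableAt (hO.mem_nhds hw)
  have heq : EqOn (fderivWithin ℝ f (Ici a ×ˢ univ)) (fderiv ℝ f) (Ici a ×ˢ univ) :=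
    fun w hw => clsB_fderivWithin_eq_fderiv hw (hdf w (hDO hw))
  rw [fderivWithin_congr heq (heq hz)]
  have h1 : ContDiffOn ℝ (⊤ : ℕ∞) (fderiv ℝ f) O :=
    hf.fderiv_of_isOpen hO (by simp)
  exact clsB_fderivWithin_eq_fderiv hz
    ((h1.differentiableOn (by simp)).differentiableAt (hO.mem_nhds (hDO hz)))


/-- **Compact limits of unbounded sequences of translates** (part B of `stub_compactLimitsOfShifts`;
the Arzelà–Ascoli statement of `stub_ascoliSmooth` is taken as the hypothesis `hAS`).  See the
module docstring. -/
theorem clsB_compactLimit_of_unbounded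
    (hAS : ∀ {G : Type} [NormedAddCommGroup G] [NormedSpace ℝ G] [FiniteDimensional ℝ G]
      (a : ℝ) (f : ℕ → ℝ × EuclideanSpace ℝ (Fin 3) → G),
      (∀ n, ContDiffOn ℝ (⊤ : ℕ∞) (f n) (Set.Ioi a ×ˢ Set.univ)) →
      (∀ m : ℕ, ∃ C : ℝ, ∀ n, ∀ z ∈ Set.Ioi a ×ˢ (Set.univ : Set (EuclideanSpace ℝ (Fin 3))),
          ‖iteratedFDeriv ℝ m (f n) z‖ ≤ C) →
      ∃ φ : ℕ → ℕ, StrictMono φ ∧ ∃ g : ℝ × EuclideanSpace ℝ (Fin 3) → G,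
        ContDiffOn ℝ (⊤ : ℕ∞) g (Set.Ioi a ×ˢ Set.univ) ∧
        (∀ m : ℕ, ∃ C : ℝ, ∀ z ∈ Set.Ioi a ×ˢ (Set.univ : Set (EuclideanSpace ℝ (Fin 3))),
            ‖iteratedFDeriv ℝ m g z‖ ≤ C) ∧
        ∀ (m : ℕ) (K : Set (ℝ × EuclideanSpace ℝ (Fin 3))), IsCompact K → K ⊆ Set.Ioi a ×ˢ Set.univ →
          TendstoUniformlyOn (fun n => iteratedFDeriv ℝ m (f (φ n))) (iteratedFDeriv ℝ m g) atTop K)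
    {ν : ℝ} {F : UnitAddTorus (Fin 3) → EuclideanSpace ℝ (Fin 3)}
    {u : ℝ → UnitAddTorus (Fin 3) → EuclideanSpace ℝ (Fin 3)} {p : ℝ → UnitAddTorus (Fin 3) → ℝ}
    (hsol : IsClassicalNSSolutionOn (Ici 0) ν (fun _ => F) u p)
    (hzm : ∀ t : ℝ, 0 ≤ t → HasZeroMean (u t))
    (hbU : ∀ m : ℕ, ∃ C : ℝ, ∀ z ∈ Set.Ioi (0 : ℝ) ×ˢ (Set.univ : Set (EuclideanSpace ℝ (Fin 3))),
      ‖iteratedFDeriv ℝ m (stLift u) z‖ ≤ C)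
    (hbP : ∀ m : ℕ, ∃ C : ℝ, ∀ z ∈ Set.Ioi (0 : ℝ) ×ˢ (Set.univ : Set (EuclideanSpace ℝ (Fin 3))),
      ‖iteratedFDeriv ℝ m (stLift (fun t x => p t x - p t 0)) z‖ ≤ C)
    {s : ℕ → ℝ} (hs : ∀ n, 1 ≤ s n) :
    ∃ φ : ℕ → ℕ, StrictMono φ ∧
      ∃ (v : ℝ → UnitAddTorus (Fin 3) → EuclideanSpace ℝ (Fin 3)) (q : ℝ → UnitAddTorus (Fin 3) → ℝ),
        IsClassicalNSSolutionOn (Ici 0) ν (fun _ => F) v q ∧ (∀ t : ℝ, 0 ≤ t → HasZeroMean (v t)) ∧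
        ∀ T ε : ℝ, 0 ≤ T → 0 < ε → ∀ᶠ n in atTop, ∀ t ∈ Icc 0 T,
          (∫ x, ‖u (t + s (φ n)) x - v t x‖ ^ 2) ≤ ε ∧
            gradNormSq (fun x => u (t + s (φ n)) x - v t x) ≤ ε := by
  set p' : ℝ → UnitAddTorus (Fin 3) → ℝ := fun t x => p t x - p t 0 with hp'
  have hsol' : IsClassicalNSSolutionOn (Ici 0) ν (fun _ => F) u p' := hsol.sub_pressure_apply 0
  set O : Set (ℝ × EuclideanSpace ℝ (Fin 3)) := Ioi (-1) ×ˢ univ with hO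
  have hOo : IsOpen O := isOpen_Ioi.prod isOpen_univ
  set D : Set (ℝ × EuclideanSpace ℝ (Fin 3)) := Ici 0 ×ˢ univ with hD
  have hDO : D ⊆ O := prod_mono (fun t (ht : 0 ≤ t) => lt_of_lt_of_le (by norm_num) ht) subset_rfl
  set f : ℕ → ℝ × EuclideanSpace ℝ (Fin 3) → EuclideanSpace ℝ (Fin 3) :=
    fun n z => stLift u (z + ((s n, 0) : ℝ × EuclideanSpace ℝ (Fin 3))) with hf
  set g : ℕ → ℝ × EuclideanSpace ℝ (Fin 3) → ℝ :=
    fun n z => stLift p' (z + ((s n, 0) : ℝ × EuclideanSpace ℝ (Fin 3))) with hg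
  have hshift : ∀ n, ∀ z ∈ O, z + ((s n, 0) : ℝ × EuclideanSpace ℝ (Fin 3)) ∈ Ioi (0 : ℝ) ×ˢ (univ : Set (EuclideanSpace ℝ (Fin 3))) := by
    intro n z hz
    refine mk_mem_prod ?_ (mem_univ _)
    have h1 : (-1 : ℝ) < z.1 := (mem_prod.1 hz).1
    show (0 : ℝ) < z.1 + s n
    linarith [hs n]
  have hshiftD : ∀ n, ∀ z ∈ O, z + ((s n, 0) : ℝ × EuclideanSpace ℝ (Fin 3)) ∈ D :=
    fun n z hz => mk_mem_prod (mem_Ici.2 (le_of_lt (mem_Ioi.1 (mem_prod.1 (hshift n z hz)).1))) (mem_univ _)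
  have hsmooth_shift : ∀ {G : Type} [NormedAddCommGroup G] [NormedSpace ℝ G]
      (w : ℝ → UnitAddTorus (Fin 3) → G), IsSmoothSpaceTimeOn (Ici 0) w → ∀ n,
      ContDiffOn ℝ (⊤ : ℕ∞) (fun z => stLift w (z + ((s n, 0) : ℝ × EuclideanSpace ℝ (Fin 3)))) O := by
    intro G _ _ w hw n
    have hw' : ContDiffOn ℝ (⊤ : ℕ∞) (stLift w) D := hw
    refine hw'.comp (contDiffOn_id.add contDiffOn_const) ?_
    exact fun z hz => hshiftD n z hz
  have hfO : ∀ n, ContDiffOn ℝ (⊤ : ℕ∞) (f n) O := fun n => hsmooth_shift u hsol.smooth_velocity n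
  have hgO : ∀ n, ContDiffOn ℝ (⊤ : ℕ∞) (g n) O := fun n => hsmooth_shift p' hsol'.smooth_pressure n
  have hbf : ∀ m : ℕ, ∃ C : ℝ, ∀ n, ∀ z ∈ O, ‖iteratedFDeriv ℝ m (f n) z‖ ≤ C := by
    intro m
    obtain ⟨C, hC⟩ := hbU m
    refine ⟨C, fun n z hz => ?_⟩
    rw [hf, iteratedFDeriv_comp_add_right]
    exact hC _ (hshift n z hz)
  have hbg : ∀ m : ℕ, ∃ C : ℝ, ∀ n, ∀ z ∈ O, ‖iteratedFDeriv ℝ m (g n) z‖ ≤ C := by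
    intro m
    obtain ⟨C, hC⟩ := hbP m
    refine ⟨C, fun n z hz => ?_⟩
    rw [hg, iteratedFDeriv_comp_add_right]
    exact hC _ (hshift n z hz)
  obtain ⟨φ₁, hφ₁, gU, hgU, -, hcU⟩ := hAS (G := EuclideanSpace ℝ (Fin 3)) (-1) f hfO hbf
  obtain ⟨φ₂, hφ₂, gP, hgP, -, hcP⟩ :=
    hAS (G := ℝ) (-1) (fun n => g (φ₁ n)) (fun n => hgO (φ₁ n))
      (fun m => by obtain ⟨C, hC⟩ := hbg m; exact ⟨C, fun n z hz => hC (φ₁ n) z hz⟩)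
  set φ : ℕ → ℕ := φ₁ ∘ φ₂ with hφ
  have hφm : StrictMono φ := hφ₁.comp hφ₂
  have hcU' : ∀ (m : ℕ) (K : Set (ℝ × EuclideanSpace ℝ (Fin 3))), IsCompact K → K ⊆ O →
      TendstoUniformlyOn (fun n => iteratedFDeriv ℝ m (f (φ n))) (iteratedFDeriv ℝ m gU) atTop K := by
    intro m K hK hKO v hv
    exact hφ₂.tendsto_atTop.eventually (hcU m K hK hKO v hv)
  have hcP' : ∀ (m : ℕ) (K : Set (ℝ × EuclideanSpace ℝ (Fin 3))), IsCompact K → K ⊆ O →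
      TendstoUniformlyOn (fun n => iteratedFDeriv ℝ m (g (φ n))) (iteratedFDeriv ℝ m gP) atTop K :=
    fun m K hK hKO => hcP m K hK hKO
  have hval : ∀ {G : Type} [NormedAddCommGroup G] [NormedSpace ℝ G]
      (k : ℕ → ℝ × EuclideanSpace ℝ (Fin 3) → G) (k₀ : ℝ × EuclideanSpace ℝ (Fin 3) → G),
      (∀ (m : ℕ) (K : Set (ℝ × EuclideanSpace ℝ (Fin 3))), IsCompact K → K ⊆ O →
        TendstoUniformlyOn (fun n => iteratedFDeriv ℝ m (k n)) (iteratedFDeriv ℝ m k₀) atTop K) →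
      ∀ z ∈ O, Tendsto (fun n => k n z) atTop (𝓝 (k₀ z)) := by
    intro G _ _ k k₀ hk z hz
    have h := (hk 0 {z} isCompact_singleton (singleton_subset_iff.2 hz)).tendsto_at (mem_singleton z)
    have hc := ((continuous_eval_const (0 : Fin 0 → ℝ × EuclideanSpace ℝ (Fin 3))).tendsto _).comp h
    simpa only [Function.comp_def, iteratedFDeriv_zero_apply] using hc
  have hper : ∀ {G : Type} [NormedAddCommGroup G] [NormedSpace ℝ G]
      (w : ℝ → UnitAddTorus (Fin 3) → G) (k₀ : ℝ × EuclideanSpace ℝ (Fin 3) → G),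
      (∀ z ∈ O, Tendsto (fun n => stLift w (z + ((s (φ n), 0) : ℝ × EuclideanSpace ℝ (Fin 3)))) atTop (𝓝 (k₀ z))) →
      ∀ t : ℝ, -1 < t → IsLatticePeriodic (fun y => k₀ (t, y)) := by
    intro G _ _ w k₀ hk t ht j y
    have hz1 : ((t, y + EuclideanSpace.single j 1) : ℝ × EuclideanSpace ℝ (Fin 3)) ∈ O := mk_mem_prod ht (mem_univ _)
    have hz2 : ((t, y) : ℝ × EuclideanSpace ℝ (Fin 3)) ∈ O := mk_mem_prod ht (mem_univ _)
    refine tendsto_nhds_unique (hk _ hz1) ?_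
    have heq : (fun n => stLift w (((t, y + EuclideanSpace.single j 1) : ℝ × EuclideanSpace ℝ (Fin 3)) +
        ((s (φ n), 0) : ℝ × EuclideanSpace ℝ (Fin 3)))) =
        fun n => stLift w (((t, y) : ℝ × EuclideanSpace ℝ (Fin 3)) + ((s (φ n), 0) : ℝ × EuclideanSpace ℝ (Fin 3))) := by
      funext n
      have e1 : ((t, y + EuclideanSpace.single j 1) : ℝ × EuclideanSpace ℝ (Fin 3)) +
          ((s (φ n), 0) : ℝ × EuclideanSpace ℝ (Fin 3)) = (t + s (φ n), (y + 0) + EuclideanSpace.single j 1) := by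
        ext <;> simp
      have e2 : ((t, y) : ℝ × EuclideanSpace ℝ (Fin 3)) + ((s (φ n), 0) : ℝ × EuclideanSpace ℝ (Fin 3)) =
          (t + s (φ n), y + 0) := rfl
      rw [e1, e2, clsB_stLift_add_single]
    rw [heq]
    exact hk _ hz2
  have hvalU : ∀ z ∈ O, Tendsto (fun n => f (φ n) z) atTop (𝓝 (gU z)) := hval (fun n => f (φ n)) gU hcU'
  have hvalP : ∀ z ∈ O, Tendsto (fun n => g (φ n) z) atTop (𝓝 (gP z)) := hval (fun n => g (φ n)) gP hcP'
  have hperU : ∀ t : ℝ, -1 < t → IsLatticePeriodic (fun y => gU (t, y)) := hper u gU hvalU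
  have hperP : ∀ t : ℝ, -1 < t → IsLatticePeriodic (fun y => gP (t, y)) := hper p' gP hvalP
  set v : ℝ → UnitAddTorus (Fin 3) → EuclideanSpace ℝ (Fin 3) := fun t x => gU (t, repr x) with hv
  set q : ℝ → UnitAddTorus (Fin 3) → ℝ := fun t x => gP (t, repr x) with hq
  have hdesc : ∀ {G : Type} [NormedAddCommGroup G] [NormedSpace ℝ G]
      (k₀ : ℝ × EuclideanSpace ℝ (Fin 3) → G), (∀ t : ℝ, -1 < t → IsLatticePeriodic (fun y => k₀ (t, y))) →
      EqOn (stLift (fun t x => k₀ (t, repr x))) k₀ O := by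
    intro G _ _ k₀ hk z hz
    obtain ⟨t, y⟩ := z
    have ht : -1 < t := (mem_prod.1 hz).1
    obtain ⟨k, hk'⟩ := exists_repr_proj_eq_add_latticeVec_holds y
    simp only [stLift_apply]
    show k₀ (t, repr (proj y)) = k₀ (t, y)
    rw [hk']
    exact IsLatticePeriodic.add_latticeVec_holds (hk t ht) y k
  have hvO : EqOn (stLift v) gU O := hdesc gU hperU
  have hqO : EqOn (stLift q) gP O := hdesc gP hperP
  have hvsm : IsSmoothSpaceTimeOn (Ici 0) v := (hgU.mono hDO).congr fun z hz => hvO (hDO hz)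
  have hqsm : IsSmoothSpaceTimeOn (Ici 0) q := (hgP.mono hDO).congr fun z hz => hqO (hDO hz)
  set uS : ℕ → ℝ → UnitAddTorus (Fin 3) → EuclideanSpace ℝ (Fin 3) := fun n t => u (t + s (φ n)) with huS
  set pS : ℕ → ℝ → UnitAddTorus (Fin 3) → ℝ := fun n t => p' (t + s (φ n)) with hpS
  have hsolS : ∀ n, IsClassicalNSSolutionOn (Ici 0) ν (fun _ => F) (uS n) (pS n) := by
    intro n
    have h := hsol'.comp_add_const (s (φ n))
    have hpre : Ici (0 : ℝ) ⊆ (· + s (φ n)) ⁻¹' Ici 0 := fun t (ht : 0 ≤ t) => by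
      show 0 ≤ t + s (φ n); linarith [hs (φ n)]
    exact h.mono hpre (uniqueDiffOn_Ici 0)
  have hliftS : ∀ n z, stLift (uS n) z = f (φ n) z := by
    intro n z; obtain ⟨t, y⟩ := z; simp [huS, hf, stLift]
  have hliftPS : ∀ n z, stLift (pS n) z = g (φ n) z := by
    intro n z; obtain ⟨t, y⟩ := z; simp [hpS, hg, stLift]
  have hliftS' : ∀ n, stLift (uS n) = f (φ n) := fun n => funext (hliftS n)
  have hliftPS' : ∀ n, stLift (pS n) = g (φ n) := fun n => funext (hliftPS n)
  have hdiffU : ∀ n, ∀ z ∈ O, DifferentiableAt ℝ (f (φ n)) z := fun n z hz =>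
    ((hfO (φ n)).differentiableOn (by simp)).differentiableAt (hOo.mem_nhds hz)
  have hdiffP : ∀ n, ∀ z ∈ O, DifferentiableAt ℝ (g (φ n)) z := fun n z hz =>
    ((hgO (φ n)).differentiableOn (by simp)).differentiableAt (hOo.mem_nhds hz)
  have hdiffgU : ∀ z ∈ O, DifferentiableAt ℝ gU z := fun z hz =>
    (hgU.differentiableOn (by simp)).differentiableAt (hOo.mem_nhds hz)
  have hdiffgP : ∀ z ∈ O, DifferentiableAt ℝ gP z := fun z hz =>
    (hgP.differentiableOn (by simp)).differentiableAt (hOo.mem_nhds hz)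
  have hfdv : ∀ z ∈ O, fderiv ℝ (stLift v) z = fderiv ℝ gU z := fun z hz =>
    Filter.EventuallyEq.fderiv_eq (hvO.eventuallyEq_of_mem (hOo.mem_nhds hz))
  have hfdq : ∀ z ∈ O, fderiv ℝ (stLift q) z = fderiv ℝ gP z := fun z hz =>
    Filter.EventuallyEq.fderiv_eq (hqO.eventuallyEq_of_mem (hOo.mem_nhds hz))
  have hdiffv : ∀ z ∈ O, DifferentiableAt ℝ (stLift v) z := fun z hz =>
    (hdiffgU z hz).congr_of_eventuallyEq (hvO.eventuallyEq_of_mem (hOo.mem_nhds hz))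
  have hdiffq : ∀ z ∈ O, DifferentiableAt ℝ (stLift q) z := fun z hz =>
    (hdiffgP z hz).congr_of_eventuallyEq (hqO.eventuallyEq_of_mem (hOo.mem_nhds hz))
  have hvO_smooth : ContDiffOn ℝ (⊤ : ℕ∞) (stLift v) O := hgU.congr hvO
  have hD1 : ∀ {G : Type} [NormedAddCommGroup G] [NormedSpace ℝ G]
      (k : ℕ → ℝ × EuclideanSpace ℝ (Fin 3) → G) (k₀ : ℝ × EuclideanSpace ℝ (Fin 3) → G),
      (∀ (m : ℕ) (K : Set (ℝ × EuclideanSpace ℝ (Fin 3))), IsCompact K → K ⊆ O →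
        TendstoUniformlyOn (fun n => iteratedFDeriv ℝ m (k n)) (iteratedFDeriv ℝ m k₀) atTop K) →
      ∀ z ∈ O, ∀ w, Tendsto (fun n => fderiv ℝ (k n) z w) atTop (𝓝 (fderiv ℝ k₀ z w)) := by
    intro G _ _ k k₀ hk z hz w
    have h := (hk 1 {z} isCompact_singleton (singleton_subset_iff.2 hz)).tendsto_at (mem_singleton z)
    have hc := ((continuous_eval_const (fun _ : Fin 1 => w)).tendsto _).comp h
    simpa [Function.comp_def, iteratedFDeriv_one_apply] using hc
  have hD2 : ∀ z ∈ O, ∀ w w', Tendsto (fun n => fderiv ℝ (fderiv ℝ (f (φ n))) z w w') atTop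
      (𝓝 (fderiv ℝ (fderiv ℝ gU) z w w')) := by
    intro z hz w w'
    have h := (hcU' 2 {z} isCompact_singleton (singleton_subset_iff.2 hz)).tendsto_at (mem_singleton z)
    have hc := ((continuous_eval_const (Fin.cons w (fun _ : Fin 1 => w'))).tendsto _).comp h
    simpa [Function.comp_def, iteratedFDeriv_two_apply] using hc
  -- the limit is a classical solution on `Ici 0`
  have hfd2 : ∀ z ∈ O, fderiv ℝ (fderiv ℝ (stLift v)) z = fderiv ℝ (fderiv ℝ gU) z := by
    intro z hz
    refine Filter.EventuallyEq.fderiv_eq ?_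
    filter_upwards [hOo.mem_nhds hz] with w hw using hfdv w hw
  have hclass : IsClassicalNSSolutionOn (Ici 0) ν (fun _ => F) v q := by
    refine clsA_limit_isClassicalNSSolutionOn' (a := 0) hsolS hvsm hqsm ?_ ?_ ?_ ?_
    · intro z hz
      have e1 : (fun n => stLift (uS n) z) = fun n => f (φ n) z := funext fun n => hliftS n z
      rw [e1, hvO (hDO hz)]
      exact hvalU z (hDO hz)
    · intro z hz w
      have e1 : ∀ n, fderivWithin ℝ (stLift (uS n)) (Ici 0 ×ˢ univ) z w = fderiv ℝ (f (φ n)) z w :=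
        fun n => by rw [hliftS' n, clsB_fderivWithin_eq_fderiv hz (hdiffU n z (hDO hz))]
      have e2 : fderivWithin ℝ (stLift v) (Ici 0 ×ˢ univ) z w = fderiv ℝ gU z w := by
        rw [clsB_fderivWithin_eq_fderiv hz (hdiffv z (hDO hz)), hfdv z (hDO hz)]
      simp only [e1, e2]
      exact hD1 (fun n => f (φ n)) gU hcU' z (hDO hz) w
    · intro z hz w w'
      have e1 : ∀ n, fderivWithin ℝ (fderivWithin ℝ (stLift (uS n)) (Ici 0 ×ˢ univ)) (Ici 0 ×ˢ univ) z w w' =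
          fderiv ℝ (fderiv ℝ (f (φ n))) z w w' :=
        fun n => by rw [hliftS' n, clsB_fderivWithin_fderivWithin_eq hOo hDO (hfO (φ n)) hz]
      have e2 : fderivWithin ℝ (fderivWithin ℝ (stLift v) (Ici 0 ×ˢ univ)) (Ici 0 ×ˢ univ) z w w' =
          fderiv ℝ (fderiv ℝ gU) z w w' := by
        rw [clsB_fderivWithin_fderivWithin_eq hOo hDO hvO_smooth hz, hfd2 z (hDO hz)]
      simp only [e1, e2]
      exact hD2 z (hDO hz) w w'
    · intro z hz w
      have e1 : ∀ n, fderivWithin ℝ (stLift (pS n)) (Ici 0 ×ˢ univ) z w = fderiv ℝ (g (φ n)) z w :=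
        fun n => by rw [hliftPS' n, clsB_fderivWithin_eq_fderiv hz (hdiffP n z (hDO hz))]
      have e2 : fderivWithin ℝ (stLift q) (Ici 0 ×ˢ univ) z w = fderiv ℝ gP z w := by
        rw [clsB_fderivWithin_eq_fderiv hz (hdiffq z (hDO hz)), hfdq z (hDO hz)]
      simp only [e1, e2]
      exact hD1 (fun n => g (φ n)) gP hcP' z (hDO hz) w
  have hsmS : ∀ n, ∀ t : ℝ, 0 ≤ t → IsSmooth (uS n t) := fun n t ht =>
    (hsolS n).smooth_velocity.isSmooth_slice (mem_Ici.2 ht)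
  have hsmv : ∀ t : ℝ, 0 ≤ t → IsSmooth (v t) := fun t ht => hvsm.isSmooth_slice (mem_Ici.2 ht)
  -- `L²`/`H¹` convergence, uniformly on `[0,T]`
  have hconv : ∀ T ε : ℝ, 0 ≤ T → 0 < ε → ∀ᶠ n in atTop, ∀ t ∈ Icc 0 T,
      (∫ x, ‖uS n t x - v t x‖ ^ 2) ≤ ε ∧ gradNormSq (fun x => uS n t x - v t x) ≤ ε := by
    intro T ε hT hε
    set C3 : Set (EuclideanSpace ℝ (Fin 3)) :=
      (WithLp.toLp 2) '' (Set.pi univ fun _ : Fin 3 => Icc (0 : ℝ) 1) with hC3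
    set K : Set (ℝ × EuclideanSpace ℝ (Fin 3)) := Icc 0 T ×ˢ C3 with hK
    have hKc : IsCompact K := isCompact_Icc.prod isCompact_toLp_image_pi_Icc
    have hKO : K ⊆ O := prod_mono (fun t ht => lt_of_lt_of_le (by norm_num) ht.1) (subset_univ _)
    obtain ⟨δ, hδ, hδε⟩ : ∃ δ : ℝ, 0 < δ ∧ 3 * δ ^ 2 ≤ ε := by
      refine ⟨Real.sqrt (ε / 3), Real.sqrt_pos.2 (by positivity), ?_⟩
      rw [Real.sq_sqrt (by positivity)]
      linarith
    have h0 := Metric.tendstoUniformlyOn_iff.1 (hcU' 0 K hKc hKO) δ hδ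
    have h1 := Metric.tendstoUniformlyOn_iff.1 (hcU' 1 K hKc hKO) δ hδ
    filter_upwards [h0, h1] with n hn0 hn1
    intro t ht
    have ht0 : (0 : ℝ) ≤ t := ht.1
    have hmem : ∀ x : UnitAddTorus (Fin 3), ((t, repr x) : ℝ × EuclideanSpace ℝ (Fin 3)) ∈ K := fun x =>
      mk_mem_prod ht (repr_mem_toLp_image_pi_Icc x)
    have hzD : ∀ x : UnitAddTorus (Fin 3), ((t, repr x) : ℝ × EuclideanSpace ℝ (Fin 3)) ∈ D := fun x =>
      mk_mem_prod (mem_Ici.2 ht0) (mem_univ _)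
    -- order 0
    have hpt : ∀ x, ‖uS n t x - v t x‖ ≤ δ := by
      intro x
      have hx := hn0 _ (hmem x)
      rw [dist_comm, dist_eq_norm] at hx
      have e1 : uS n t x = f (φ n) (t, repr x) := by
        have := hliftS n (t, repr x)
        simpa [stLift] using this
      have e2 : v t x = gU (t, repr x) := rfl
      have key : ‖f (φ n) (t, repr x) - gU (t, repr x)‖ ≤
          ‖iteratedFDeriv ℝ 0 (f (φ n)) (t, repr x) - iteratedFDeriv ℝ 0 gU (t, repr x)‖ := by
        have h := (iteratedFDeriv ℝ 0 (f (φ n)) (t, repr x) - iteratedFDeriv ℝ 0 gU (t, repr x)).le_opNorm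
          (0 : Fin 0 → ℝ × EuclideanSpace ℝ (Fin 3))
        simpa [iteratedFDeriv_zero_apply] using h
      rw [e1, e2]
      exact key.trans hx.le
    -- order 1
    have hpt1 : ∀ i x, ‖partialDeriv i (uS n t) x - partialDeriv i (v t) x‖ ≤ δ := by
      intro i x
      have hx := hn1 _ (hmem x)
      rw [dist_comm, dist_eq_norm] at hx
      set z : ℝ × EuclideanSpace ℝ (Fin 3) := (t, repr x) with hz
      set w : ℝ × EuclideanSpace ℝ (Fin 3) := (0, EuclideanSpace.single i 1) with hw
      have e1 : partialDeriv i (uS n t) x = fderiv ℝ (f (φ n)) z w := by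
        have h := clsA_partialDeriv_slice_eq (hsolS n).smooth_velocity (mem_Ici.2 ht0) (repr x) i
        rw [proj_repr] at h
        rw [h, hliftS' n, clsB_fderivWithin_eq_fderiv (hzD x) (hdiffU n z (hDO (hzD x)))]
      have e2 : partialDeriv i (v t) x = fderiv ℝ gU z w := by
        have h := clsA_partialDeriv_slice_eq hvsm (mem_Ici.2 ht0) (repr x) i
        rw [proj_repr] at h
        rw [h, clsB_fderivWithin_eq_fderiv (hzD x) (hdiffv z (hDO (hzD x))), hfdv z (hDO (hzD x))]
      have hwn : ‖w‖ ≤ 1 := by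
        rw [hw, Prod.norm_def]
        simp
      have key : ‖fderiv ℝ (f (φ n)) z w - fderiv ℝ gU z w‖ ≤
          ‖iteratedFDeriv ℝ 1 (f (φ n)) z - iteratedFDeriv ℝ 1 gU z‖ * ‖w‖ := by
        have h := (iteratedFDeriv ℝ 1 (f (φ n)) z - iteratedFDeriv ℝ 1 gU z).le_opNorm (fun _ : Fin 1 => w)
        simpa [iteratedFDeriv_one_apply] using h
      rw [e1, e2]
      calc ‖fderiv ℝ (f (φ n)) z w - fderiv ℝ gU z w‖
          ≤ ‖iteratedFDeriv ℝ 1 (f (φ n)) z - iteratedFDeriv ℝ 1 gU z‖ * ‖w‖ := key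
        _ ≤ δ * 1 := mul_le_mul hx.le hwn (norm_nonneg _) hδ.le
        _ = δ := mul_one δ
    refine ⟨(clsA_integral_norm_sub_sq_le hpt).trans (by nlinarith), ?_⟩
    exact (clsA_gradNormSq_sub_le (hsmS n t ht0) (hsmv t ht0) hpt1).trans hδε
  -- mean zero of the limit
  have hzmv : ∀ t : ℝ, 0 ≤ t → HasZeroMean (v t) := by
    intro t ht
    refine clsA_hasZeroMean_of_tendsto (f := fun n => uS n t) (fun n => hsmS n t ht) (hsmv t ht)
      (fun n => hzm _ (by show (0 : ℝ) ≤ t + s (φ n); linarith [hs (φ n)])) ?_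
    rw [Metric.tendsto_nhds]
    intro ε hε
    filter_upwards [hconv t (ε / 2) ht (half_pos hε)] with n hn
    have h := (hn t ⟨ht, le_rfl⟩).1
    have h0 : 0 ≤ ∫ x, ‖uS n t x - v t x‖ ^ 2 := integral_nonneg fun _ => sq_nonneg _
    rw [Real.dist_eq, sub_zero, abs_of_nonneg h0]
    linarith
  exact ⟨φ, hφm, v, q, hclass, hzmv, hconv⟩

/-- Registered form (explicit binders) of `clsB_compactLimit_of_unbounded`: compact limits of
sequences of translates `u(· + sₙ)`, `sₙ ≥ 1`, of a forward classical mean-zero Navier–Stokes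
solution whose lifts have all derivatives bounded, granting the Arzelà–Ascoli statement of
`stub_ascoliSmooth`. -/
theorem clsB_compactLimitUnbounded :
    (∀ {G : Type} [NormedAddCommGroup G] [NormedSpace ℝ G] [FiniteDimensional ℝ G]
      (a : ℝ) (f : ℕ → ℝ × EuclideanSpace ℝ (Fin 3) → G),
      (∀ n, ContDiffOn ℝ (⊤ : ℕ∞) (f n) (Set.Ioi a ×ˢ Set.univ)) →
      (∀ m : ℕ, ∃ C : ℝ, ∀ n, ∀ z ∈ Set.Ioi a ×ˢ (Set.univ : Set (EuclideanSpace ℝ (Fin 3))),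
          ‖iteratedFDeriv ℝ m (f n) z‖ ≤ C) →
      ∃ φ : ℕ → ℕ, StrictMono φ ∧ ∃ g : ℝ × EuclideanSpace ℝ (Fin 3) → G,
        ContDiffOn ℝ (⊤ : ℕ∞) g (Set.Ioi a ×ˢ Set.univ) ∧
        (∀ m : ℕ, ∃ C : ℝ, ∀ z ∈ Set.Ioi a ×ˢ (Set.univ : Set (EuclideanSpace ℝ (Fin 3))),
            ‖iteratedFDeriv ℝ m g z‖ ≤ C) ∧
        ∀ (m : ℕ) (K : Set (ℝ × EuclideanSpace ℝ (Fin 3))), IsCompact K → K ⊆ Set.Ioi a ×ˢ Set.univ →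
          TendstoUniformlyOn (fun n => iteratedFDeriv ℝ m (f (φ n))) (iteratedFDeriv ℝ m g) atTop K) →
    ∀ (ν : ℝ) (F : UnitAddTorus (Fin 3) → EuclideanSpace ℝ (Fin 3))
      (u : ℝ → UnitAddTorus (Fin 3) → EuclideanSpace ℝ (Fin 3)) (p : ℝ → UnitAddTorus (Fin 3) → ℝ),
      IsClassicalNSSolutionOn (Set.Ici 0) ν (fun _ => F) u p →
      (∀ t : ℝ, 0 ≤ t → HasZeroMean (u t)) →
      (∀ m : ℕ, ∃ C : ℝ, ∀ z ∈ Set.Ioi (0 : ℝ) ×ˢ (Set.univ : Set (EuclideanSpace ℝ (Fin 3))),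
        ‖iteratedFDeriv ℝ m (stLift u) z‖ ≤ C) →
      (∀ m : ℕ, ∃ C : ℝ, ∀ z ∈ Set.Ioi (0 : ℝ) ×ˢ (Set.univ : Set (EuclideanSpace ℝ (Fin 3))),
        ‖iteratedFDeriv ℝ m (stLift (fun t x => p t x - p t 0)) z‖ ≤ C) →
      ∀ s : ℕ → ℝ, (∀ n, 1 ≤ s n) →
        ∃ φ : ℕ → ℕ, StrictMono φ ∧
          ∃ (v : ℝ → UnitAddTorus (Fin 3) → EuclideanSpace ℝ (Fin 3)) (q : ℝ → UnitAddTorus (Fin 3) → ℝ),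
            IsClassicalNSSolutionOn (Set.Ici 0) ν (fun _ => F) v q ∧ (∀ t : ℝ, 0 ≤ t → HasZeroMean (v t)) ∧
            ∀ T ε : ℝ, 0 ≤ T → 0 < ε → ∀ᶠ n in atTop, ∀ t ∈ Set.Icc 0 T,
              (∫ x, ‖u (t + s (φ n)) x - v t x‖ ^ 2) ≤ ε ∧
                gradNormSq (fun x => u (t + s (φ n)) x - v t x) ≤ ε :=
  fun hAS _ _ _ _ hsol hzm hbU hbP _ hs => clsB_compactLimit_of_unbounded hAS hsol hzm hbU hbP hs

end Summit.AnomalousDissipation.AnomalousDissipation.Theorems.ChainRealisation.SeparatrixFluxPinning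

end
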